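/-
Copyright (c) 2026. All rights reserved.
Released under Apache 2.0 license as described in the file LICENSE.
Authors: abc-iut cell, statement-typer seat abc-iut-L4-t3 (wave 1).
-/
import Literature.AnabelianGeometry.AbsoluteAnabelian.LogFrobeniusRigidity

/-!
# [AbsTopIII] Corollary 5.5 (v): the shifts of `D•⊢` ARE equivalences of diagrams of categories (proof-only companion)

S. Mochizuki, *Topics in absolute anabelian geometry III* [MochizukiAbsTopIII2015], Cor 5.5 (v) pp. 131–132 (proof
p. 133: "the remainder of assertion (v) is immediate from the definitions and constructions made thus far"); Def 3.5
(v), (vi) pp. 76–77 (`DiagramMorphisms.lean`, seat abc-iut-L4-t2).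

Proof-only companion of `LogFrobeniusRigidity.lean` (no new notions). It DISCHARGES the formal clauses (1) and (2) of
the named fact `LogFrobeniusSetting.Cor55ShiftAction` for EVERY setting `L`:
* `shiftOneMorphism_isEquivalence` — each shift `L.shiftOneMorphism k` is an equivalence of diagrams of categories in
  the sense of Def 3.5 (v) (quasi-inverse: the shift by `-k`); hence (`shift_isNexusClass`) a nexus self-equivalence of
  `D•⊢` relative to `□` — the first inhabited instance of `OneMorphism.IsEquivalence` in the tree;
* `shiftOneMorphism_zero_isomorphic_id`, `shiftOneMorphism_comp_isomorphic` — the group law: the shift by `0` is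
  [2-]isomorphic to the identity 1-morphism and the composite of the shifts by `k`, `l` to the shift by `k + l` (after
  transport along the equality of the underlying morphisms of oriented graphs `DVertex.shiftGraph_zero`,
  `DVertex.shiftGraph_comp`);
* `cor55ShiftAction_iff` — consequently `Cor55ShiftAction L` is EQUIVALENT to its clause (3) alone (compatibility of the
  shifts with one family of homotopies realising the cores of (i) and the observables of (iii)), which is the genuinely
  `L`-dependent content.
Tools: `Prefunctor.ext_of_heq` (equality of morphisms of quivers from `HEq` of the arrow maps) and
`OneMorphism.transport_isomorphic` (a transported 1-morphism with identity-like 2-cells is 2-isomorphic to another such).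
Refereed pre-IUT material; nothing here bears on [IUTchIII] Cor. 3.12.
-/

set_option autoImplicit false

universe v u w u'

open CategoryTheory Quiver

namespace Literature.AnabelianGeometry.AbsoluteAnabelian

/-! ## Two transport tools -/

/-- two morphisms of quivers with equal vertex maps and heterogeneously equal arrow maps are equal. [folklore] -/
private theorem Prefunctor.ext_of_heq {V : Type u} [Quiver.{v} V] {W : Type u'} [Quiver.{w} W] {F G : V ⥤q W}
    (h_obj : ∀ X, F.obj X = G.obj X) (h_map : ∀ (X Y : V) (f : X ⟶ Y), HEq (F.map f) (G.map f)) : F = G := by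
  obtain ⟨Fo, Fm⟩ := F
  obtain ⟨Go, Gm⟩ := G
  obtain rfl : Fo = Go := funext h_obj
  have hm : @Fm = @Gm := by
    funext X Y f
    exact eq_of_heq (h_map X Y f)
  cases hm
  rfl

section EqToHomCalculus

variable {C : Type u} [Category.{v} C] {C' : Type u'} [Category.{w} C']

/-- an identity is an `eqToHom`. [folklore] -/
private theorem exists_eq_eqToHom_id (X : C) : ∃ h : X = X, 𝟙 X = eqToHom h := ⟨rfl, rfl⟩

/-- a composite of two `eqToHom`s is an `eqToHom`. [folklore] -/
private theorem exists_eq_eqToHom_comp {X Y Z : C} {f : X ⟶ Y} {g : Y ⟶ Z} (hf : ∃ h, f = eqToHom h)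
    (hg : ∃ h, g = eqToHom h) : ∃ h, f ≫ g = eqToHom h := by
  obtain ⟨p, rfl⟩ := hf
  obtain ⟨q, rfl⟩ := hg
  exact ⟨p.trans q, eqToHom_trans p q⟩

/-- a functor maps an `eqToHom` to an `eqToHom`. [folklore] -/
private theorem exists_eq_eqToHom_map (F : C ⥤ C') {X Y : C} {f : X ⟶ Y} (hf : ∃ h, f = eqToHom h) :
    ∃ h, F.map f = eqToHom h := by
  obtain ⟨p, rfl⟩ := hf
  exact ⟨congrArg F.obj p, eqToHom_map F p⟩

/-- a component of an `eqToHom` between functors is an `eqToHom`. [folklore] -/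
private theorem exists_eq_eqToHom_app {F G : C ⥤ C'} {α : F ⟶ G} (hα : ∃ h, α = eqToHom h) (X : C) :
    ∃ h, α.app X = eqToHom h := by
  obtain ⟨p, rfl⟩ := hα
  exact ⟨Functor.congr_obj p X, eqToHom_app p X⟩

/-- two `eqToHom`s with the same source and target are equal. [folklore] -/
private theorem eq_of_exists_eq_eqToHom {X Y : C} {f g : X ⟶ Y} (hf : ∃ h, f = eqToHom h) (hg : ∃ h, g = eqToHom h) :
    f = g := by
  obtain ⟨p, rfl⟩ := hf
  obtain ⟨q, rfl⟩ := hg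
  rfl

end EqToHomCalculus

namespace DiagramOfCategories

variable {V : Type w} [Quiver.{v} V] {D : DiagramOfCategories.{v, u, w} V}

/-- a 1-morphism `X` of `𝒟` to itself whose vertex functors agree (heterogeneously) with those of a 1-morphism `Y` and
whose edge 2-cells, like those of `Y`, are `eqToIso`s, is [2-]isomorphic to `Y` after transport along the equality of
the underlying morphisms of oriented graphs (Def 3.5 (v)). [cite: MochizukiAbsTopIII2015, Definition 3.5 (v) p.76] -/
theorem OneMorphism.transport_isomorphic {P Q : V ⥤q V} (X : OneMorphism P D D) (Y : OneMorphism Q D D)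
    (h : P = Q) (happ : ∀ a, HEq (X.app a) (Y.app a))
    (hX : ∀ {a b : V} (e : a ⟶ b), ∃ H, X.iso e = eqToIso H)
    (hY : ∀ {a b : V} (e : a ⟶ b), ∃ H, Y.iso e = eqToIso H) :
    (h ▸ X).Isomorphic Y := by
  subst h
  show X.Isomorphic Y
  have happ' : ∀ a, X.app a = Y.app a := fun a => eq_of_heq (happ a)
  refine ⟨⟨fun a => eqToHom (happ' a), fun {a b} e => ?_⟩, fun a => ?_⟩
  · obtain ⟨HX, hHX⟩ := hX e
    obtain ⟨HY, hHY⟩ := hY e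
    ext x
    refine eq_of_exists_eq_eqToHom ?_ ?_
    · exact exists_eq_eqToHom_comp
        (exists_eq_eqToHom_map _ (exists_eq_eqToHom_app (α := eqToHom (happ' a)) ⟨happ' a, rfl⟩ x))
        (by rw [hHY]; exact exists_eq_eqToHom_app (α := (eqToIso HY).hom) ⟨HY, eqToIso.hom HY⟩ x)
    · exact exists_eq_eqToHom_comp
        (by rw [hHX]; exact exists_eq_eqToHom_app (α := (eqToIso HX).hom) ⟨HX, eqToIso.hom HX⟩ x)
        (exists_eq_eqToHom_app (α := eqToHom (happ' b)) ⟨happ' b, rfl⟩ ((D.map e).obj x))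
  · show IsIso (eqToHom (happ' a))
    infer_instance

/-- the edge 2-cells of the identity 1-morphism are `eqToIso`s. [cite: MochizukiAbsTopIII2015, Definition 3.5 (v) p.76] -/
theorem OneMorphism.id_iso_eq_eqToIso {a b : V} (e : a ⟶ b) :
    ∃ H, (OneMorphism.id D).iso e = eqToIso H := by
  have H : 𝟭 (D.obj a) ⋙ D.map e = D.map e ⋙ 𝟭 (D.obj b) := (Functor.id_comp _).trans (Functor.comp_id _).symm
  refine ⟨H, ?_⟩
  ext x
  exact eq_of_exists_eq_eqToHom
    (exists_eq_eqToHom_comp (exists_eq_eqToHom_id ((D.map e).obj x)) (exists_eq_eqToHom_id ((D.map e).obj x)))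
    (exists_eq_eqToHom_app (α := (eqToIso H).hom) ⟨H, eqToIso.hom H⟩ x)

end DiagramOfCategories

variable {Vmod : Type u} {isArc : Vmod → Bool}

/-! ## The shift graph maps compose according to the group law of `ℤ` -/

namespace DVertex

/-- `log` arrows with equal indices are (heterogeneously) equal. [cite: MochizukiAbsTopIII2015, Cor 5.5 (v) p. 132] -/
theorem heq_log {i j : ℤ} (h : i = j) : HEq (DEdge.log (isArc := isArc) i) (DEdge.log (isArc := isArc) j) := by
  subst h; rfl

/-- `id_⋎` arrows with equal indices are (heterogeneously) equal. [cite: MochizukiAbsTopIII2015, Cor 5.5 (v) p. 132] -/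
theorem heq_toCore {i j : ℤ} (h : i = j) :
    HEq (DEdge.toCore (isArc := isArc) i) (DEdge.toCore (isArc := isArc) j) := by
  subst h; rfl

/-- the shift on arrows respects heterogeneous equality of arrows. [cite: MochizukiAbsTopIII2015, Cor 5.5 (v) p. 132] -/
theorem shiftHom_heq (k : ℤ) {a a' b b' : DVertex Vmod isArc} (ha : a = a') (hb : b = b') {e : a ⟶ b}
    {e' : a' ⟶ b'} (he : HEq e e') : HEq (shiftHom k e) (shiftHom k e') := by
  subst ha hb
  obtain rfl := eq_of_heq he
  rfl

/-- the shift of a `log` arrow is, heterogeneously, a `log` arrow. [cite: MochizukiAbsTopIII2015, Cor 5.5 (v) p. 132] -/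
theorem shiftHom_log_heq (k n : ℤ) :
    HEq (shiftHom k (DEdge.log (isArc := isArc) n)) (DEdge.log (isArc := isArc) (n + k)) := by
  rw [LogFrobeniusSetting.shiftHom_log]
  exact Quiver.Hom.cast_heq _ _ _

/-- composing the shifts on arrows: heterogeneously the shift by the sum. [cite: MochizukiAbsTopIII2015, Cor 5.5 (v) p. 132] -/
theorem shiftHom_shiftHom_heq (k l : ℤ) {a b : DVertex Vmod isArc} (e : a ⟶ b) :
    HEq (shiftHom l (shiftHom k e)) (shiftHom (k + l) e) := by
  cases e with
  | log n =>
    refine ((shiftHom_heq l (congrArg DVertex.row1 (Int.add_right_comm n 1 k)) rfl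
      (shiftHom_log_heq k n)).trans ((shiftHom_log_heq l (n + k)).trans ?_))
    exact (heq_log (by rw [Int.add_assoc])).trans (shiftHom_log_heq (k + l) n).symm
  | toCore n => exact heq_toCore (Int.add_assoc n k l)
  | _ => exact HEq.rfl

/-- the shift by `0` on arrows is, heterogeneously, the identity. [cite: MochizukiAbsTopIII2015, Cor 5.5 (v) p. 132] -/
theorem shiftHom_zero_heq {a b : DVertex Vmod isArc} (e : a ⟶ b) : HEq (shiftHom 0 e) e := by
  cases e with
  | log n => exact (shiftHom_log_heq 0 n).trans (heq_log (Int.add_zero n))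
  | toCore n => exact heq_toCore (Int.add_zero n)
  | _ => exact HEq.rfl

/-- **group law of the shifts, on oriented graphs**: `shift k` then `shift l` is `shift (k + l)`.
[cite: MochizukiAbsTopIII2015, Cor 5.5 (v) p. 132] -/
theorem shiftGraph_comp (k l : ℤ) :
    shiftGraph (Vmod := Vmod) (isArc := isArc) k ⋙q shiftGraph l = shiftGraph (k + l) :=
  Prefunctor.ext_of_heq (fun x => (DVertex.shift_add k l x).symm) fun _ _ e => shiftHom_shiftHom_heq k l e

/-- the shift by `0` is the identity morphism of oriented graphs. [cite: MochizukiAbsTopIII2015, Cor 5.5 (v) p. 132] -/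
theorem shiftGraph_zero : shiftGraph (Vmod := Vmod) (isArc := isArc) 0 = 𝟭q (DVertex Vmod isArc) :=
  Prefunctor.ext_of_heq (fun x => DVertex.shift_zero x) fun _ _ e => shiftHom_zero_heq e

end DVertex

/-! ## The shifts are equivalences of diagrams of categories; the group law -/

namespace LogFrobeniusSetting

variable (L : LogFrobeniusSetting Vmod isArc)

/-- the vertex functors of the shift are identity functors (heterogeneously). [cite: MochizukiAbsTopIII2015, Cor 5.5 (v) p. 132] -/
theorem shiftApp_heq_id (k : ℤ) (a : DVertex Vmod isArc) : HEq (L.shiftApp k a) (𝟭 (a.category L)) := by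
  cases a <;> exact HEq.rfl

/-- the vertex functors of a composite of two shifts are identity functors (heterogeneously).
[cite: MochizukiAbsTopIII2015, Cor 5.5 (v) p. 132] -/
theorem shiftApp_comp_heq_id (k l : ℤ) (a : DVertex Vmod isArc) :
    HEq (L.shiftApp k a ⋙ L.shiftApp l (a.shift k)) (𝟭 (a.category L)) := by
  cases a <;> exact HEq.rfl

/-- the edge 2-cells of a shift are `eqToIso`s (by construction). [cite: MochizukiAbsTopIII2015, Cor 5.5 (v) p. 132] -/
theorem shiftOneMorphism_iso_eq (k : ℤ) {a b : DVertex Vmod isArc} (e : a ⟶ b) :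
    ∃ H, (L.shiftOneMorphism k).iso e = eqToIso H :=
  ⟨L.shift_comm k e, rfl⟩

/-- the composite of two shifts commutes strictly with the functors of `D•⊢`. [cite: MochizukiAbsTopIII2015, Cor 5.5 (v) p. 132] -/
theorem shift_comp_comm (k l : ℤ) {a b : DVertex Vmod isArc} (e : a ⟶ b) :
    (L.shiftApp k a ⋙ L.shiftApp l (a.shift k)) ⋙ DEdge.functor L (DVertex.shiftHom l (DVertex.shiftHom k e)) =
      DEdge.functor L e ⋙ (L.shiftApp k b ⋙ L.shiftApp l (b.shift k)) := by
  rw [Functor.assoc, L.shift_comm l (DVertex.shiftHom k e), ← Functor.assoc, L.shift_comm k e, Functor.assoc]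

/-- the edge 2-cells of a composite of two shifts are `eqToIso`s. [cite: MochizukiAbsTopIII2015, Cor 5.5 (v) p. 132] -/
theorem shiftOneMorphism_comp_iso_eq (k l : ℤ) {a b : DVertex Vmod isArc} (e : a ⟶ b) :
    ∃ H, ((L.shiftOneMorphism k).comp (L.shiftOneMorphism l)).iso e = eqToIso H := by
  have H := L.shift_comp_comm k l e
  refine ⟨H, ?_⟩
  ext x
  refine eq_of_exists_eq_eqToHom ?_ (exists_eq_eqToHom_app (α := (eqToIso H).hom) ⟨H, eqToIso.hom H⟩ x)
  exact exists_eq_eqToHom_comp (exists_eq_eqToHom_id _)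
    (exists_eq_eqToHom_comp
      (exists_eq_eqToHom_app (α := eqToHom (L.shift_comm l (DVertex.shiftHom k e)))
        ⟨L.shift_comm l (DVertex.shiftHom k e), rfl⟩ _)
      (exists_eq_eqToHom_comp (exists_eq_eqToHom_id _)
        (exists_eq_eqToHom_comp
          (exists_eq_eqToHom_map _ (exists_eq_eqToHom_app (α := eqToHom (L.shift_comm k e))
            ⟨L.shift_comm k e, rfl⟩ x))
          (exists_eq_eqToHom_id _))))

/-- **the group law, unit**: the shift by `0` is [2-]isomorphic to the identity 1-morphism of `D•⊢` (after transport
along `shiftGraph_zero`). [cite: MochizukiAbsTopIII2015, Cor 5.5 (v) p. 132] -/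
theorem shiftOneMorphism_zero_isomorphic_id :
    (DVertex.shiftGraph_zero (Vmod := Vmod) (isArc := isArc) ▸ L.shiftOneMorphism 0).Isomorphic
      (DiagramOfCategories.OneMorphism.id L.diagram) :=
  DiagramOfCategories.OneMorphism.transport_isomorphic _ _ _ (fun a => L.shiftApp_heq_id 0 a)
    (fun e => L.shiftOneMorphism_iso_eq 0 e) (fun e => DiagramOfCategories.OneMorphism.id_iso_eq_eqToIso e)

/-- **the group law, multiplication**: the composite of the shifts by `k` and `l` is [2-]isomorphic to the shift by
`k + l` (after transport along `shiftGraph_comp`). [cite: MochizukiAbsTopIII2015, Cor 5.5 (v) p. 132] -/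
theorem shiftOneMorphism_comp_isomorphic (k l : ℤ) :
    (DVertex.shiftGraph_comp (Vmod := Vmod) (isArc := isArc) k l ▸
      (L.shiftOneMorphism k).comp (L.shiftOneMorphism l)).Isomorphic (L.shiftOneMorphism (k + l)) :=
  DiagramOfCategories.OneMorphism.transport_isomorphic _ _ _
    (fun a => (L.shiftApp_comp_heq_id k l a).trans (L.shiftApp_heq_id (k + l) a).symm)
    (fun e => L.shiftOneMorphism_comp_iso_eq k l e) (fun e => L.shiftOneMorphism_iso_eq (k + l) e)

/-- **Cor 5.5 (v), clause (1) DISCHARGED**: every shift `L.shiftOneMorphism k` is an equivalence of diagrams of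
categories (Def 3.5 (v)), with quasi-inverse the shift by `-k`. [cite: MochizukiAbsTopIII2015, Cor 5.5 (v) p. 132] -/
theorem shiftOneMorphism_isEquivalence (k : ℤ) : (L.shiftOneMorphism k).IsEquivalence := by
  have h₁ : DVertex.shiftGraph (Vmod := Vmod) (isArc := isArc) k ⋙q DVertex.shiftGraph (-k) =
      𝟭q (DVertex Vmod isArc) := by
    rw [DVertex.shiftGraph_comp, Int.add_right_neg, DVertex.shiftGraph_zero]
  have h₂ : DVertex.shiftGraph (Vmod := Vmod) (isArc := isArc) (-k) ⋙q DVertex.shiftGraph k =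
      𝟭q (DVertex Vmod isArc) := by
    rw [DVertex.shiftGraph_comp, Int.add_left_neg, DVertex.shiftGraph_zero]
  refine ⟨DVertex.shiftGraph (-k), L.shiftOneMorphism (-k), h₁, h₂, ?_, ?_⟩
  · exact DiagramOfCategories.OneMorphism.transport_isomorphic _ _ _ (fun a => L.shiftApp_comp_heq_id k (-k) a)
      (fun e => L.shiftOneMorphism_comp_iso_eq k (-k) e)
      (fun e => DiagramOfCategories.OneMorphism.id_iso_eq_eqToIso e)
  · exact DiagramOfCategories.OneMorphism.transport_isomorphic _ _ _ (fun a => L.shiftApp_comp_heq_id (-k) k a)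
      (fun e => L.shiftOneMorphism_comp_iso_eq (-k) k e)
      (fun e => DiagramOfCategories.OneMorphism.id_iso_eq_eqToIso e)

/-- hence every shift is a NEXUS self-equivalence of `D•⊢` relative to `□` (Def 3.5 (vi)), unconditionally.
[cite: MochizukiAbsTopIII2015, Cor 5.5 (v) p. 132] -/
theorem shiftSelfEquivalence_isNexusClass (k : ℤ) :
    (⟨DVertex.shiftGraph k, L.shiftOneMorphism k, L.shiftOneMorphism_isEquivalence k⟩ :
      L.diagram.SelfEquivalence).IsNexusClass .core DVertex.rowOne :=
  L.shift_isNexusClass k (L.shiftOneMorphism_isEquivalence k)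

/-- **Cor 5.5 (v), clauses (1)–(2) DISCHARGED**: `Cor55ShiftAction L` is equivalent to its clause (3) (compatibility of
the shifts with one family of homotopies realising the cores of (i) and the observables of (iii)).
[cite: MochizukiAbsTopIII2015, Cor 5.5 (v) pp. 131–132] -/
theorem cor55ShiftAction_iff : L.Cor55ShiftAction ↔
    ∃ K : L.diagram.HomotopyFamily, L.RealisesCor55Families K ∧
      ∀ k : ℤ, Nonempty ((L.shiftOneMorphism k).CompatibleWith K K) := by
  refine ⟨fun h => h.2.2.2, fun h => ⟨L.shiftOneMorphism_isEquivalence, ?_, ?_, h⟩⟩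
  · exact ⟨DVertex.shiftGraph_zero, L.shiftOneMorphism_zero_isomorphic_id⟩
  · exact fun k l => ⟨DVertex.shiftGraph_comp k l, L.shiftOneMorphism_comp_isomorphic k l⟩

end LogFrobeniusSetting

end Literature.AnabelianGeometry.AbsoluteAnabelian
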